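import Mathlib
import HarnessLib
import Literature.Analysis.FluidPDE.VorticityCalculus
import Summits.NavierStokesRegularity.NavierStokesRegularity.Theorems.UnthreadedDoorAntidynamoWallSymmetricSector

/-!
# Route `UnthreadedDoor` / `ThreadingFlux`, crux `PoloidalLiouville` (stmt-NavierStokesRegularity-1222), antidynamo v2 skeleton
# (sha16 `4ebf5683127b`): THE WALL ON THE TIME-PERIODIC (AND STEADY) VORTICITY SECTOR WITH A DRIFTING CENTRE

Support file (seat leafhand-ns-unthreadeddoor-2 g0, cell decomp-ns), `--supports stmt-NavierStokesRegularity-1222 --as helper`; theorems only.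
The temporal counterpart of `…WallSymmetricSector` (p814882).  If the VORTICITY of the wall's flow is time-periodic with period `τ > 0`
(`curl v(t − τ) = curl v(t)` for all `t < 0`; a steady vorticity is periodic of every period), the time-shifted field `u(t) = v(t − τ)` — again in
the class (`timeShift_class`, p814783) — is a Galilean twin of `v`: `u − v` is curl-free, divergence-free and bounded, hence the spatial constant
`k(t) = v(t − τ, x₀) − v(t, x₀)`, and `fderiv_curl_apply_eq_zero_of_galileanTwin` makes `k(t)` a flat direction of the vorticity.  If the centre
velocity is NOT `τ`-periodic on a far past (`v(t − τ, x₀) ≠ v(t, x₀)` for all `t < t₁`), `curl_eq_zero_of_flat_direction_farPast` gives `curl v ≡ 0`.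

* ★★ `curl_eq_zero_of_curl_periodic_of_centre_not_periodic_farPast` / `constant_…` / `stubScalarLiouville_of_potential_periodic_of_centre_not_periodic_farPast`.

MEANING FOR THE WALL: the time-periodic-vorticity sector collapses to GENUINELY time-periodic flows (velocity periodic at times `tₙ → −∞`), the
steady-vorticity sector to genuinely steady ones — the classical steady / time-periodic bounded Liouville problems, open in print.
HONEST LABEL: a sector of the wall; nothing here proves `stub_scalarLiouville`, `PoloidalLiouville` (1222), or bears on Navier–Stokes regularity;
no summit statement is proved. [folklore] [cite: KochNadirashviliSereginSverak2009, Thm 5.2 (arXiv:0709.3599 pp. 9–10)]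
-/

noncomputable section

-- the summit and its single sub-problem share the name (CONVENTIONS §1)
set_option linter.dupNamespace false

open scoped Topology InnerProductSpace RealInnerProductSpace ContDiff
open Filter Set Function Metric MeasureTheory
open Literature.Analysis.FluidPDE

namespace Summit.NavierStokesRegularity.NavierStokesRegularity.Theorems.PoloidalLiouville.Antidynamo

open Summit.NavierStokesRegularity.NavierStokesRegularity.Theorems.PoloidalLiouville
  (constantOfIrrotational vorticityOfClass)

/-- ★★ **TIME-PERIODIC VORTICITY WITH A NON-PERIODIC CENTRE VELOCITY ⇒ IRROTATIONAL.**  Let `v` be a bounded ancient mild solution (`ν = 1`,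
duality class) with measurable slices, jointly smooth on `(−∞,0) × ℝ³`, unthreaded about `x₀`, whose vorticity is `τ`-periodic in time
(`τ > 0`): `curl v(t − τ) = curl v(t)` for all `t < 0`.  If `v(t − τ, x₀) ≠ v(t, x₀)` for all `t < t₁` (some `t₁ ≤ 0`), then `curl v ≡ 0` on
`(−∞,0) × ℝ³`. [cite: KochNadirashviliSereginSverak2009, Thm 5.2 (arXiv:0709.3599 pp. 9–10)] -/
theorem curl_eq_zero_of_curl_periodic_of_centre_not_periodic_farPast
    (v : ℝ → EuclideanSpace ℝ (Fin 3) → EuclideanSpace ℝ (Fin 3)) (x₀ : EuclideanSpace ℝ (Fin 3))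
    (hB : Literature.Analysis.FluidPDE.IsBoundedAncientMildSolution 1 v)
    (hm : ∀ t < 0, AEStronglyMeasurable (v t) volume)
    (hsm : ContDiffOn ℝ (⊤ : ℕ∞) (Function.uncurry v) (Set.Iio 0 ×ˢ Set.univ))
    (hun : ∀ t < 0, ∀ x, ⟪x - x₀, curl (v t) x⟫ = 0)
    {τ : ℝ} (hτ : 0 < τ) (hper : ∀ t < 0, ∀ x, curl (v (t - τ)) x = curl (v t) x)
    (hne : ∃ t₁ ≤ 0, ∀ t < t₁, v (t - τ) x₀ ≠ v t x₀) :
    ∀ t < 0, ∀ x, curl (v t) x = 0 := by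
  have hsm' : IsSmoothSpaceTimeOn (Iio 0) v := hsm
  obtain ⟨M, hM⟩ := hB.isBoundedOn
  -- the shifted field `u s = v (s − τ)` is in the class
  obtain ⟨hBu, hmu, hsmu⟩ := timeShift_class hB hm hsm (show -τ ≤ 0 by linarith)
  have hsub : ∀ s : ℝ, s + -τ = s - τ := fun s => by ring
  -- it is a Galilean twin of `v`
  set k : ℝ → EuclideanSpace ℝ (Fin 3) := fun s => v (s - τ) x₀ - v s x₀ with hk
  have htwin : ∀ s < 0, ∀ y, (fun s y => v (s + -τ) y) s y = v s y + k s := by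
    intro s hs y
    have hsτ : s - τ < 0 := by linarith
    have hvs : ContDiff ℝ ∞ (v s) := hsm'.contDiff_slice hs
    have hus : ContDiff ℝ ∞ (v (s - τ)) := hsm'.contDiff_slice hsτ
    have hv2 : ContDiff ℝ 2 (v s) := hvs.of_le (by norm_cast)
    have hu2 : ContDiff ℝ 2 (v (s - τ)) := hus.of_le (by norm_cast)
    set W : EuclideanSpace ℝ (Fin 3) → EuclideanSpace ℝ (Fin 3) := fun y => v (s - τ) y - v s y with hW
    have hW2 : ContDiff ℝ 2 W := hu2.sub hv2
    have hud : ∀ y, DifferentiableAt ℝ (v (s - τ)) y := fun y => (hu2.differentiable (by norm_num)) y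
    have hvd : ∀ y, DifferentiableAt ℝ (v s) y := fun y => (hv2.differentiable (by norm_num)) y
    have hWcurl : ∀ y, curl W y = 0 := fun y => by
      rw [hW, curl_sub (hud y) (hvd y), hper s hs y, sub_self]
    have hdivv : VectorCalculus.IsDivFree (v s) :=
      (hB.isAncientMildSolution.1 s hs).isDivFree_of_contDiff (hvs.of_le (by norm_cast))
    have hdivu : VectorCalculus.IsDivFree (v (s - τ)) :=
      (hB.isAncientMildSolution.1 (s - τ) hsτ).isDivFree_of_contDiff (hus.of_le (by norm_cast))
    have hWdiv : VectorCalculus.IsDivFree W := by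
      intro y
      have h1 := hdivu y
      have h2 := hdivv y
      simp only [VectorCalculus.divergence] at h1 h2 ⊢
      rw [hW, fderiv_fun_sub (hud y) (hvd y), ContinuousLinearMap.toLinearMap_sub, map_sub, h1, h2, sub_zero]
    have hWb : ∀ y, ‖W y‖ ≤ M + M := fun y =>
      (norm_sub_le _ _).trans (add_le_add (hM (s - τ) hsτ y) (hM s hs y))
    have hWy : W y = W x₀ := eq_of_curl_eq_zero_of_isDivFree_of_bounded hW2 hWcurl hWdiv hWb y x₀
    have hWx0 : W x₀ = k s := by simp only [hW, hk]
    show v (s + -τ) y = v s y + k s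
    calc v (s + -τ) y = W y + v s y := by rw [hsub, hW, sub_add_cancel]
      _ = v s y + k s := by rw [hWy, hWx0, add_comm]
  obtain ⟨hV, -⟩ := vorticityOfClass v hB hm hsm
  obtain ⟨hU, -⟩ := vorticityOfClass (fun s y => v (s + -τ) y) hBu hmu hsmu
  obtain ⟨t₁, ht₁, hne⟩ := hne
  exact curl_eq_zero_of_flat_direction_farPast v x₀ hB hm hsm hun
    ⟨t₁, ht₁, fun t ht => ⟨k t, sub_ne_zero.2 (hne t ht), fun x =>
      fderiv_curl_apply_eq_zero_of_galileanTwin hV hU k htwin (by linarith) x⟩⟩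

/-- ★★ **… HENCE SLICE-WISE CONSTANT** (`constantOfIrrotational`). [cite: KochNadirashviliSereginSverak2009, Thm 5.2 (arXiv:0709.3599 pp. 9–10)] -/
theorem constant_of_curl_periodic_of_centre_not_periodic_farPast
    (v : ℝ → EuclideanSpace ℝ (Fin 3) → EuclideanSpace ℝ (Fin 3)) (x₀ : EuclideanSpace ℝ (Fin 3))
    (hB : Literature.Analysis.FluidPDE.IsBoundedAncientMildSolution 1 v)
    (hm : ∀ t < 0, AEStronglyMeasurable (v t) volume)
    (hsm : ContDiffOn ℝ (⊤ : ℕ∞) (Function.uncurry v) (Set.Iio 0 ×ˢ Set.univ))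
    (hun : ∀ t < 0, ∀ x, ⟪x - x₀, curl (v t) x⟫ = 0)
    {τ : ℝ} (hτ : 0 < τ) (hper : ∀ t < 0, ∀ x, curl (v (t - τ)) x = curl (v t) x)
    (hne : ∃ t₁ ≤ 0, ∀ t < t₁, v (t - τ) x₀ ≠ v t x₀) :
    ∀ t < 0, ∃ b : EuclideanSpace ℝ (Fin 3), ∀ x, v t x = b :=
  constantOfIrrotational v hB hsm (curl_eq_zero_of_curl_periodic_of_centre_not_periodic_farPast v x₀ hB hm hsm hun hτ hper hne)

/-- ★★ **THE WALL'S LETTER, TIME-PERIODIC TOROIDAL FIELD.**  If the vorticity of the wall's flow is `∇T(t, ·) × (· − x₀)`, the toroidal field is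
`τ`-periodic in time (`∇T(t − τ, x) × (x − x₀) = ∇T(t, x) × (x − x₀)`, e.g. `T` itself `τ`-periodic or steady) and the centre velocity is not
(`v(t − τ, x₀) ≠ v(t, x₀)` on a far past), then `∇T × (x − x₀) ≡ 0`. [cite: KochNadirashviliSereginSverak2009, Thm 5.2 (arXiv:0709.3599 pp. 9–10)] -/
theorem stubScalarLiouville_of_potential_periodic_of_centre_not_periodic_farPast
    (v : ℝ → EuclideanSpace ℝ (Fin 3) → EuclideanSpace ℝ (Fin 3)) (x₀ : EuclideanSpace ℝ (Fin 3))
    (T : ℝ → EuclideanSpace ℝ (Fin 3) → ℝ)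
    (hB : Literature.Analysis.FluidPDE.IsBoundedAncientMildSolution 1 v)
    (hm : ∀ t < 0, AEStronglyMeasurable (v t) volume)
    (hsm : ContDiffOn ℝ (⊤ : ℕ∞) (Function.uncurry v) (Set.Iio 0 ×ˢ Set.univ))
    (hrep : ∀ t < 0, ∀ x, Literature.Analysis.FluidPDE.curl (v t) x =
      Literature.Analysis.FluidPDE.cross (gradient (T t) x) (x - x₀))
    {τ : ℝ} (hτ : 0 < τ)
    (hTper : ∀ t < 0, ∀ x, Literature.Analysis.FluidPDE.cross (gradient (T (t - τ)) x) (x - x₀) =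
      Literature.Analysis.FluidPDE.cross (gradient (T t) x) (x - x₀))
    (hne : ∃ t₁ ≤ 0, ∀ t < t₁, v (t - τ) x₀ ≠ v t x₀) :
    ∀ t < 0, ∀ x, Literature.Analysis.FluidPDE.cross (gradient (T t) x) (x - x₀) = 0 := by
  -- a toroidal field is tangent to the spheres about its centre: `⟪y, a × y⟫ = 0`
  have hun : ∀ t < 0, ∀ x, ⟪x - x₀, curl (v t) x⟫ = 0 := fun t ht x => by
    rw [hrep t ht x]
    simp [cross, crossProduct, PiLp.inner_apply, Fin.sum_univ_three]
    ring
  have hper : ∀ t < 0, ∀ x, curl (v (t - τ)) x = curl (v t) x := fun t ht x => by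
    rw [hrep t ht x, hrep (t - τ) (by linarith) x]
    exact hTper t ht x
  intro t ht x
  rw [← hrep t ht x]
  exact curl_eq_zero_of_curl_periodic_of_centre_not_periodic_farPast v x₀ hB hm hsm hun hτ hper hne t ht x

end Summit.NavierStokesRegularity.NavierStokesRegularity.Theorems.PoloidalLiouville.Antidynamo

end
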